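import Mathlib
import HarnessLib

/-!
# HodgeLocusCensusExSet103Certs — part of the (10,3,m) characteristic-0 exceptional-set anchor

certified instances and evidence bearing on the general Hodge conjecture; no claim.

This file is one of the files that together form the anchor `HodgeLocusCensusExSet103Char0` (split by the 400-line rule for Theorems files);
the mathematics, the record (`run/shared/lean/pub/pub-hlocus/pub-hlocus-ivhs-2/gen25/record/M103-CHAR0-g25.md`), the two programs and the division of
labour between the Lean kernel and the computation are described in THAT file's module docstring.  This file: §2 of the anchor: the certificate polynomials g₁, g₂ (implementation B in the three cells; implementation A in the cells where its exact run is in) as coefficient lists, their factorisations as polynomial identities over ℂ, and their complex zero sets (`certificate_zero_set_10mmB`, and `…A` / `certificate_zero_sets_agree_10mm` where both are in).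
Nothing here is a statement about the Hodge conjecture; recorded program output is marked as such in each docstring.
-/

namespace Summit.HodgeConjecture.HodgeConjecture.HodgeLocus.Census.ExSet103Char0

/-! ## 2. The certificate polynomials and their complex zero sets (implementation B in every cell; implementation A where its exact run is available) -/

/-- Evaluation of an integer coefficient list (low degree first, as both programs print polynomials in λ) at a complex number. -/
def evalCoeffs (l : List ℤ) (z : ℂ) : ℂ := (l.zipIdx.map fun ⟨c, i⟩ => (c : ℂ) * z ^ i).sum


/-- g₁ of implementation B at C1034: gcd of 5 distinct pivot-structure 30×30 minors of B(λ) (8 values λ₀ × 5 scan orders; determinants by Dixon lifting + interpolation), low degree first. Each of these 5 exact minors, reduced mod p = 1000003, is reproduced from implementation A's mod-p matrices B(0), B′ (`gen25/xcheck/xcheck_modp.py`; log md5 7e44276884eec835a91f3e6cae7306de: 5/5). -/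
def g1B1034 : List ℤ :=
  [0, 0, 0, 0, 0, 0, 0, 0, 0, 0, 1, -10, 45, -120, 210, -252, 210, -120, 45, -10, 1]

/-- `g1B1034` is the coefficient list of (1)·λ^10·(λ − (1))^10. -/
theorem eval_g1B1034 (z : ℂ) : evalCoeffs g1B1034 z = (1:ℂ) * z ^ 10 * (z - (1:ℂ)) ^ 10 := by
  simp [evalCoeffs, g1B1034, List.zipIdx]; ring

/-- g₂ of implementation B at C1034: gcd of 5 of B's own pivot-structure maximal minors of N(λ) = [B(λ)] (size 30; e = 0: no q-columns), low degree first. -/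
def g2B1034 : List ℤ :=
  [0, 0, 0, 0, 0, 0, 0, 0, 0, 0, 1, -10, 45, -120, 210, -252, 210, -120, 45, -10, 1]

/-- `g2B1034` is the coefficient list of (1)·λ^10·(λ − (1))^10. -/
theorem eval_g2B1034 (z : ℂ) : evalCoeffs g2B1034 z = (1:ℂ) * z ^ 10 * (z - (1:ℂ)) ^ 10 := by
  simp [evalCoeffs, g2B1034, List.zipIdx]; ring

/-- CHARACTERISTIC-0 STATEMENT (1034, implementation B): the complex zero set of g₁·g₂ — the finite λ (engine normalisation = geometric, s₁ = +1) at which the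
tangent rank of V_λ at X can drop below c — is exactly {0, 1}. -/
theorem certificate_zero_set_1034B : {z : ℂ | evalCoeffs g1B1034 z * evalCoeffs g2B1034 z = 0} = {(0:ℂ), (1:ℂ)} := by
  ext z
  simp only [Set.mem_setOf_eq, eval_g1B1034, eval_g2B1034, Set.mem_insert_iff, Set.mem_singleton_iff]
  constructor
  · intro h
    rcases mul_eq_zero.mp h with h | h
    · rcases mul_eq_zero.mp h with h | h
      · rcases mul_eq_zero.mp h with h | h
        · exact absurd h (by norm_num)
        · exact Or.inl ((pow_eq_zero_iff (by norm_num)).mp h)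
      · exact Or.inr (sub_eq_zero.mp ((pow_eq_zero_iff (by norm_num)).mp h))
    · rcases mul_eq_zero.mp h with h | h
      · rcases mul_eq_zero.mp h with h | h
        · exact absurd h (by norm_num)
        · exact Or.inl ((pow_eq_zero_iff (by norm_num)).mp h)
      · exact Or.inr (sub_eq_zero.mp ((pow_eq_zero_iff (by norm_num)).mp h))
  · intro h
    rcases h with h | h <;> subst h <;> norm_num

/-! At C1034 implementation A's EXACT certificates are not part of this file (its exact run, kit j149719, had not finished when the file was written); A's contribution at C1034 is the mod-p record of §3 (`canonAp1034`, agreement `canonAp1034_agrees_canonB1034`) and the reproduction of B's exact minors mod p noted above. -/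

/-- g₁ of implementation B at C1033: gcd of 5 distinct pivot-structure 36×36 minors of B(λ) (8 values λ₀ × 5 scan orders; determinants by Dixon lifting + interpolation), low degree first. Each of these 5 exact minors, reduced mod p = 1000003, is reproduced from implementation A's mod-p matrices B(0), B′ (`gen25/xcheck/xcheck_modp.py`; log md5 b982b08f8590768e9a0097fc886af3bb: 5/5). -/
def g1B1033 : List ℤ :=
  [0, 0, 0, 0, 0, 0, 0, 0, 0, 0, 0, 0, 0, 0, 0, 0, 1, 4, 6, 4, 1]

/-- `g1B1033` is the coefficient list of (1)·λ^16·(λ − (-1))^4. -/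
theorem eval_g1B1033 (z : ℂ) : evalCoeffs g1B1033 z = (1:ℂ) * z ^ 16 * (z - (-1:ℂ)) ^ 4 := by
  simp [evalCoeffs, g1B1033, List.zipIdx]; ring

/-- g₂ of implementation B at C1033: gcd of 5 of B's own pivot-structure maximal minors of N(λ) = [B(λ)] (size 36; e = 0: no q-columns), low degree first. -/
def g2B1033 : List ℤ :=
  [0, 0, 0, 0, 0, 0, 0, 0, 0, 0, 0, 0, 0, 0, 0, 0, 1, 4, 6, 4, 1]

/-- `g2B1033` is the coefficient list of (1)·λ^16·(λ − (-1))^4. -/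
theorem eval_g2B1033 (z : ℂ) : evalCoeffs g2B1033 z = (1:ℂ) * z ^ 16 * (z - (-1:ℂ)) ^ 4 := by
  simp [evalCoeffs, g2B1033, List.zipIdx]; ring

/-- CHARACTERISTIC-0 STATEMENT (1033, implementation B): the complex zero set of g₁·g₂ — the finite λ (engine normalisation = geometric, s₁ = +1) at which the
tangent rank of V_λ at X can drop below c — is exactly {-1, 0}. -/
theorem certificate_zero_set_1033B : {z : ℂ | evalCoeffs g1B1033 z * evalCoeffs g2B1033 z = 0} = {(-1:ℂ), (0:ℂ)} := by
  ext z
  simp only [Set.mem_setOf_eq, eval_g1B1033, eval_g2B1033, Set.mem_insert_iff, Set.mem_singleton_iff]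
  constructor
  · intro h
    rcases mul_eq_zero.mp h with h | h
    · rcases mul_eq_zero.mp h with h | h
      · rcases mul_eq_zero.mp h with h | h
        · exact absurd h (by norm_num)
        · exact Or.inr ((pow_eq_zero_iff (by norm_num)).mp h)
      · exact Or.inl (sub_eq_zero.mp ((pow_eq_zero_iff (by norm_num)).mp h))
    · rcases mul_eq_zero.mp h with h | h
      · rcases mul_eq_zero.mp h with h | h
        · exact absurd h (by norm_num)
        · exact Or.inr ((pow_eq_zero_iff (by norm_num)).mp h)
      · exact Or.inl (sub_eq_zero.mp ((pow_eq_zero_iff (by norm_num)).mp h))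
  · intro h
    rcases h with h | h <;> subst h <;> norm_num

/-! At C1033 implementation A's EXACT certificates are not part of this file (its exact run, kit j149719, had not finished when the file was written); A's contribution at C1033 is the mod-p record of §3 (`canonAp1033`, agreement `canonAp1033_agrees_canonB1033`) and the reproduction of B's exact minors mod p noted above. -/

/-- g₁ of implementation B at C1032: gcd of 5 distinct pivot-structure 39×39 minors of B(λ) (8 values λ₀ × 5 scan orders; determinants by Dixon lifting + interpolation), low degree first. Each of these 5 exact minors, reduced mod p = 1000003, is reproduced from implementation A's mod-p matrices B(0), B′ (`gen25/xcheck/xcheck_modp.py`; log md5 92626761f75d4f7ef839ac3ad22781cd: 5/5). -/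
def g1B1032 : List ℤ :=
  [0, 0, 0, 0, 0, 0, 0, 0, 0, 0, 0, 0, 0, 0, 0, 0, 0, 0, 0, -1, 1]

/-- `g1B1032` is the coefficient list of (1)·λ^19·(λ − (1))^1. -/
theorem eval_g1B1032 (z : ℂ) : evalCoeffs g1B1032 z = (1:ℂ) * z ^ 19 * (z - (1:ℂ)) ^ 1 := by
  simp [evalCoeffs, g1B1032, List.zipIdx]; ring

/-- g₂ of implementation B at C1032: gcd of 5 of B's own pivot-structure maximal minors of N(λ) = [B(λ)] (size 39; e = 0: no q-columns), low degree first. -/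
def g2B1032 : List ℤ :=
  [0, 0, 0, 0, 0, 0, 0, 0, 0, 0, 0, 0, 0, 0, 0, 0, 0, 0, 0, -1, 1]

/-- `g2B1032` is the coefficient list of (1)·λ^19·(λ − (1))^1. -/
theorem eval_g2B1032 (z : ℂ) : evalCoeffs g2B1032 z = (1:ℂ) * z ^ 19 * (z - (1:ℂ)) ^ 1 := by
  simp [evalCoeffs, g2B1032, List.zipIdx]; ring

/-- CHARACTERISTIC-0 STATEMENT (1032, implementation B): the complex zero set of g₁·g₂ — the finite λ (engine normalisation = geometric, s₁ = +1) at which the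
tangent rank of V_λ at X can drop below c — is exactly {0, 1}. -/
theorem certificate_zero_set_1032B : {z : ℂ | evalCoeffs g1B1032 z * evalCoeffs g2B1032 z = 0} = {(0:ℂ), (1:ℂ)} := by
  ext z
  simp only [Set.mem_setOf_eq, eval_g1B1032, eval_g2B1032, Set.mem_insert_iff, Set.mem_singleton_iff]
  constructor
  · intro h
    rcases mul_eq_zero.mp h with h | h
    · rcases mul_eq_zero.mp h with h | h
      · rcases mul_eq_zero.mp h with h | h
        · exact absurd h (by norm_num)
        · exact Or.inl ((pow_eq_zero_iff (by norm_num)).mp h)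
      · exact Or.inr (sub_eq_zero.mp ((pow_eq_zero_iff (by norm_num)).mp h))
    · rcases mul_eq_zero.mp h with h | h
      · rcases mul_eq_zero.mp h with h | h
        · exact absurd h (by norm_num)
        · exact Or.inl ((pow_eq_zero_iff (by norm_num)).mp h)
      · exact Or.inr (sub_eq_zero.mp ((pow_eq_zero_iff (by norm_num)).mp h))
  · intro h
    rcases h with h | h <;> subst h <;> norm_num

/-! At C1032 implementation A's EXACT certificates are not part of this file (its exact run, kit j149719, had not finished when the file was written); A's contribution at C1032 is the mod-p record of §3 (`canonAp1032`, agreement `canonAp1032_agrees_canonB1032`) and the reproduction of B's exact minors mod p noted above. -/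

end Summit.HodgeConjecture.HodgeConjecture.HodgeLocus.Census.ExSet103Char0
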